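import Mathlib
import Summits.PneNP.PneNP.Theses.AeaCutRectangles

/-!
# Sketch — crux-ideate r2 seat 2 (g13) on `AeaCutRectangles.FoolingMeasure` (stmt-PneNP-19727)

First-lemma signatures for the card `saturated-ruler-systems` (overlapping normal rulers in ONE
bounded-degree graph).  Nothing here is proved; every `def` is a `Prop`.
-/

namespace Summit.PneNP.PneNP.Cruxes.FoolingMeasure.R2s2g13

open Finset

/-- Forward displacement from `u` to `v` along the cyclic order `σ` (position map `σ.symm`). -/
def disp {n : ℕ} (σ : Equiv.Perm (Fin n)) (u v : Fin n) : ℕ :=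
  ((σ.symm v : ℕ) + n - (σ.symm u : ℕ)) % n

/-- `σ` is a NORMAL RULER of the edge set `S` on `Fin n`: `n ≡ 1 (mod 3)`, consecutive vertices of the
cyclic order are edges of `S`, and every edge of `S` is either consecutive in `σ` or makes a jump `≡ 2 (mod 3)`
in BOTH directions.  (Overlap with other rulers is allowed: an edge may be consecutive in several rulers.) -/
def IsNormalRuler {n : ℕ} (S : Finset (Sym2 (Fin n))) (σ : Equiv.Perm (Fin n)) : Prop :=
  n % 3 = 1 ∧
  (∀ u : Fin n, ∃ v : Fin n, disp σ u v = 1 ∧ s(u, v) ∈ S) ∧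
  ∀ u v : Fin n, s(u, v) ∈ S →
    disp σ u v = 1 ∨ disp σ v u = 1 ∨ (disp σ u v % 3 = 2 ∧ disp σ v u % 3 = 2)

/-- An edge `e` of `S` is a RULER EDGE of `σ`: its endpoints are consecutive in the cyclic order. -/
def IsRulerEdge {n : ℕ} (σ : Equiv.Perm (Fin n)) (e : Sym2 (Fin n)) : Prop :=
  ∃ u v : Fin n, e = s(u, v) ∧ disp σ u v = 1

/-- FIRST LEMMA (kernel of the line; the NCS seam-colouring fact, stated for overlapping rulers):
deleting any ruler edge of a normal ruler leaves a 3-colourable graph (the seam colouring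
`v ↦ ((pos v − s) mod n) mod 3` is proper off the seam edge). -/
def SeamColouring : Prop :=
  ∀ n : ℕ, ∀ S : Finset (Sym2 (Fin n)), ∀ σ : Equiv.Perm (Fin n), IsNormalRuler S σ →
    ∀ e ∈ S, IsRulerEdge σ e →
      (SimpleGraph.fromEdgeSet ((S.erase e : Finset (Sym2 (Fin n))) : Set (Sym2 (Fin n)))).Colorable 3

/-- Consequence used by the card: a non-3-colourable loopless `S` every edge of which is a ruler edge of SOME
normal ruler is 4-edge-critical (criticality certified ruler by ruler, with rulers sharing edges). -/
def SaturatedCritical : Prop :=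
  ∀ n : ℕ, ∀ S : Finset (Sym2 (Fin n)),
    (∀ e ∈ S, ∃ σ : Equiv.Perm (Fin n), IsNormalRuler S σ ∧ IsRulerEdge σ e) →
    ∀ e ∈ S, (SimpleGraph.fromEdgeSet ((S.erase e : Finset (Sym2 (Fin n))) : Set (Sym2 (Fin n)))).Colorable 3

/-- Two rulers are TRANSVERSAL if they share at most `n / 3` ruler edges (the regime in which, empirically,
their seam colourings are zero-winding inequivalent, i.e. count as different frames). -/
def Transversal {n : ℕ} (σ τ : Equiv.Perm (Fin n)) : Prop :=
  (Finset.univ.filter fun u : Fin n => ∃ v : Fin n, disp σ u v = 1 ∧ (disp τ u v = 1 ∨ disp τ v u = 1)).card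
    ≤ n / 3

/-- EXISTENCE CRUX of the card (the quantitative bet, first-moment window `t ≤ 2.36·log₃ n` at degree 6):
for some fixed degree bound `d`, for every `C`, for infinitely many `n` there is a loopless
non-3-colourable edge set of maximum degree `≤ d` carrying at least `C · log₃ n`-many pairwise transversal
normal rulers whose ruler edges cover `S`. -/
def SaturatedSystemsExist : Prop :=
  ∃ d : ℕ, ∀ C : ℕ, ∃ᶠ n in Filter.atTop, ∃ S : Finset (Sym2 (Fin n)),
    (∀ e ∈ S, ¬ e.IsDiag) ∧
    (∀ u : Fin n, (S.filter fun e => u ∈ e).card ≤ d) ∧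
    ¬ (SimpleGraph.fromEdgeSet (S : Set (Sym2 (Fin n)))).Colorable 3 ∧
    ∃ 𝓡 : Finset (Equiv.Perm (Fin n)),
      C * Nat.log 3 n ≤ 𝓡.card ∧
      (∀ σ ∈ 𝓡, IsNormalRuler S σ) ∧
      (∀ σ ∈ 𝓡, ∀ τ ∈ 𝓡, σ ≠ τ → Transversal σ τ) ∧
      (∀ e ∈ S, ∃ σ ∈ 𝓡, IsRulerEdge σ e)

end Summit.PneNP.PneNP.Cruxes.FoolingMeasure.R2s2g13
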